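import Summits.BirchSwinnertonDyer.BirchSwinnertonDyer.Theses.ErratumRoadFive
import Summits.BirchSwinnertonDyer.BirchSwinnertonDyer.Theorems.ErratumRoadFiveErratumThm23OfTwoVarCoreLocalDefect
import Summits.BirchSwinnertonDyer.BirchSwinnertonDyer.Theorems.ErratumRoadFiveLocalDefectOfFiniteFixed

/-!
# v6 (PROPOSED by bsd-stepL-imc-p1 g23, 2026-08-28; v5 by g23, v4 by g22, v3 by g21) of the birth skeleton `Lines/erratum_chain.lean`
# (lens `complete`) — crux `ErratumRoadFive.ErratumThm23SigmaLe` (item stmt-BirchSwinnertonDyer-25505): the erratum's OWN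
# proof chain of Thm. 2.3 «⊂»

Seat `bsd-idea-9` (D-0154 ideator, lens complete) authored v1 (b48130e54ed2e67c); v2 (RULING 51, imc-p1 g20) shrank S2
`stub_JSW_sigmaDescent` to `stub_control`; v3 (registered, a8e337d24de47a07): the CONTROL [JSW17, §3.4 + Lemma 3.4.1] is a
tree THEOREM in the exact case (`Theorems.ErratumThm23TwoVariable.ControlAt.*`, imc-p1 g21) and the corner stub
`stub_cornerLocalTorsion` = F4♯ on `¬(dec)`; v4 (imc-p1 g22, turnkey 21373ba61b1efee5): the corner reduced to the FINITENESS of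
the LOCAL control defect `𝓜^{Γ_{K_𝔭̄}}/T_c` (S2♭♭ `stub_localDefectFiniteAnomalous`) via finite-defect control
(`ControlFiniteDefect.*`) and `ErratumChainV4.erratumThm23SigmaLe_of_twoVarCore_of_localDefect` (p638561). v5/v6 (this file): S2♭♭ is
now a tree THEOREM modulo ONE GALOIS INPUT about `A_g` and `Γ_{K_𝔭̄}` only — the kernel ASSEMBLY
`Theorems.ErratumThm23TwoVariable.Sections.*` (p641531) ∕ `LocalDefect.finite_quotSMulTop_X_invariants_of_open` (p641842) ∕
`LocalDefectAtData.stub_localDefectFiniteAnomalous_of_inputs` (p642621) ∕ `…_of_finN` (imc-p1 g23): the invariants `𝓜^G` of the iterate are the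
SECTIONS `Φ(z + c g) = ρ(g)Φ(z)` over the finite coset space `ℤ_p²/c(G)`, `c = (κ_cyc, κ_ac)|_{Γ_{K_𝔭̄}}`; evaluation at
representatives is a bijection onto `(A_g^{ker c})^R` (uniform smoothness from COMPACTNESS of `Γ_{K_𝔭̄}`), under which
`(1+T_c)^{p^t} − 1` is `ρ(σ₁) − 1` on the values. So the stubs are:

* S1 `stub_FW21_twoVarSigmaLePinned` — THE OPEN CORE, byte-identical with v1–v4.
* ((OPEN) — the decomposition group at `𝔭̄` is OPEN in `Gal(K̃_∞/K) ≅ ℤ_p × ℤ_p` via `(κ', κ)` — is NOT a stub any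
  more: it is the Literature THEOREM `ZpExtension.exists_pow_mul_mem_image_decomp` (imc-p1 g23, file
  `ZpExtensionDecompositionOpenImageProofs`: Rubin 1991 §5 "`D_𝔭` and `D_𝔭*` both have finite index in `𝒢`", from the
  tree's `exists_mem_decomp_combination_ne_zero` + independence of the cyclotomic and the anticyclotomic line + Cramer),
  consumed through `LocalDefectAtData.openDecompositionAtPbar` ∕ `stub_localDefectFiniteAnomalous_of_finN`.)
* S2″ `stub_finiteFixedPartAnomalous` — (FIX): for every `σ₁ ∈ Γ_{K_𝔭̄}` trivial on the `κ`-tower and non-trivial on the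
  `κ'`-tower, only finitely many `a ∈ A_g` are fixed by `P = ker κ| ∩ ker κ'| = G_{K̃_{∞,𝔭̄}}` and by `σ₁` ("`V_g^{⟨P,σ₁⟩} = 0`"). The v5
  stub (FIN-N) (finitely many classes of `A_g^P` mod `(ρ(σ₁) − 1)A_g^P`) FOLLOWS from it (`FinN.exists_finset_repr_of_finite_fixed`,
  p644528: `A_g` is `p`-primary with finite `p^k`-torsion; on finite levels `#coker = #ker`). TRUE for every ordinary newform datum
  (memo `LOCALDEFECT-25505-imc-p1-g23.md` §1: `A_g^P ∩ A⁺ = 0` by a `(p−1)`-torsion inertia element, `A_g^P ↪ (F/𝒪)(φ)`, and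
  `φ(σ₁) ≠ 1` by local rank two + `κ_ac` ramified above `p` + [Wiles88 Thm 2.2] `φ(Frob) = α_p` no root of unity [Deligne]). Not a
  printed lemma (the honest residue of [JSW17, L.3.4.1]'s "finite"); kernel discharge needs the characters of `Δ.fil` as named facts.

Composition `ErratumThm23SigmaLe_of` (sorry-free, BY NAME):
`ErratumChainV4.erratumThm23SigmaLe_of_twoVarCore_of_localDefect hFW (LocalDefectAtData.stub_localDefectFiniteAnomalous_of_finiteFixed hX)`.
TWO stubs (S1 = the OPEN core [FW21]; S2″ = the one remaining Galois input (FIX), TRUE). No summit statement and no crux is proved here; BSD is not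
advanced by this file. Stub statements by name: `Statement.stub_*`.

[claim: FouquetWan2021, Thm. 4.41, App. B Cor. 7.21, Lemma 7.22, status: under-review] [claim: Castella2018Erratum, Thm. 2.3, status: under-review]
[cite: JetchevSkinnerWan2017, §3.4, Lemma 3.4.1, Cor. 3.4.2] [cite: CastellaGrossiSkinner2025, Prop. 2.4.5] [cite: Hsieh2014, Thm. B]
[cite: Castella2018, Def. 2.2, (3.1)] [cite: Castella2018Erratum, Lemma 2.1] [cite: Wiles1988, Thm. 2.2]
-/

noncomputable section

-- D-0017: single-problem summit, the namespace repeats the problem name by design.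
set_option linter.dupNamespace false

open scoped Classical

open PowerSeries NumberField IsDedekindDomain Field
  Literature.NumberTheory.EllipticCurves Literature.NumberTheory.EllipticCurves.ModularForms
  Literature.NumberTheory.EllipticCurves.BigGaloisRep Literature.NumberTheory.EllipticCurves.GreenbergSelmer
  Literature.NumberTheory.GaloisRepresentations

namespace Summit.BirchSwinnertonDyer.BirchSwinnertonDyer.Cruxes.ErratumThm23SigmaLe.ErratumChain

/-! ## Registered stubs -/

/-- **S1 · `stub_FW21_twoVarSigmaLePinned` — the OPEN two-variable core (FW21 Thm. 4.41, Σ-imprimitive, with the anticyclotomic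
restriction of the frame pinned to `L^Σ_p(g)` by FW21 App. B Cor. 7.21 ∕ L. 7.22 + CGS25 Prop. 2.4.5 (weight `k`) + Hsieh2014 Thm. B).**
F4♯'s binders verbatim up to the Σ-BDP frame `Q`; then a CYCLOTOMIC `κ'` with generator `γ'`, the two topologies, and the `Λ_K`-torsion
premise for the iterated big dual Selmer group `X^Σ_K(A_g) := XBig κ' (AnticyclotomicBigGaloisRep κ (A_g|Γ_K)) 𝔭̄ Σ`.
[claim: FouquetWan2021, Thm. 4.41 + App. B Cor. 7.21, status: under-review] [cite: CastellaGrossiSkinner2025, Prop. 2.4.5] [cite: Hsieh2014, Thm. B] -/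
theorem stub_FW21_twoVarSigmaLePinned :
    ∀ {p : ℕ} [Fact p.Prime] (ι : PadicAlgCl p ≃+* ℂ) {M : ℕ} [NeZero M] {k : ℤ}
      (g : CuspForm (CongruenceSubgroup.Gamma0 M) k) (ιg : coeffField g →+* PadicAlgCl p)
      (Δ : OrdinaryNewformDatum g p ιg)
      (K : Type) [Field K] [NumberField K] (𝔭 𝔭bar : HeightOneSpectrum (𝓞 K)) (κ : ZpExtension K p)
      (γ : absoluteGaloisGroup K) [Fact (κ.IsTopGenerator γ)] (S : Finset (HeightOneSpectrum (𝓞 K))),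
      IsNewform0 g → 2 ≤ k → Even k → 3 ≤ M → ¬ p ∣ M → 3 < p →
      (∀ x : coeffField g, ι (ιg x) = (x : ℂ)) →
      ‖ιg ⟨(UpperHalfPlane.qExpansion 1 ⇑g).coeff p, coeff_mem_coeffField g p⟩‖ = 1 →
      IsImaginaryQuadratic K → (∃ β : ℤ, (4 * M : ℤ) ∣ β ^ 2 - NumberField.discr K) →
      ((Ideal.span {(p : ℤ)}).primesOver (𝓞 K)).ncard = 2 →
      ((p : ℕ) : 𝓞 K) ∈ 𝔭.asIdeal →
      (∀ (w : InfinitePlace K) (x : 𝓞 K), x ∈ 𝔭.asIdeal ↔ ‖ι.symm (w.embedding (x : K))‖ < 1) →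
      ((p : ℕ) : 𝓞 K) ∈ 𝔭bar.asIdeal → 𝔭bar ≠ 𝔭 →
      SkinnerUrban2014.IsResiduallyIrreducible Δ →
      (∃ v : HeightOneSpectrum (𝓞 ℚ), SkinnerUrban2014.IsResiduallyRamifiedAt Δ v ∧
        ((Rat.HeightOneSpectrum.primesEquiv v : Nat.Primes) : ℕ) ∣ M ∧
        ¬ ((Rat.HeightOneSpectrum.primesEquiv v : Nat.Primes) : ℕ) ^ 2 ∣ M ∧
        ((Ideal.span {(((Rat.HeightOneSpectrum.primesEquiv v : Nat.Primes) : ℕ) : ℤ)}).primesOver (𝓞 K)).ncard ≠ 2) →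
      (((Ideal.span {(2 : ℤ)}).primesOver (𝓞 K)).ncard ≠ 2 → (2 ∣ M ∧ ¬ 4 ∣ M)) →
      (∀ ℓ : ℕ, ℓ.Prime → ℓ ∣ M → ((Ideal.span {(ℓ : ℤ)}).primesOver (𝓞 K)).ncard ≠ 2 →
        ¬ ℓ ^ 2 ∣ M ∧ (UpperHalfPlane.qExpansion 1 ⇑g).coeff ℓ = -((ℓ : ℂ) ^ (k / 2 - 1).toNat)) →
      κ.IsAnticyclotomic → (∀ w ∈ S, ((p : ℕ) : 𝓞 K) ∉ w.asIdeal) →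
      (∀ w : HeightOneSpectrum (𝓞 K), ((M : ℕ) : 𝓞 K) ∈ w.asIdeal → w ∈ S) →
      ∀ (b : padicCoeffIntegers ιg →+* PadicComplexInt p),
        (∀ x, ((b x : PadicComplexInt p) : ℂ_[p]) =
          algebraMap (PadicAlgCl p) ℂ_[p] (padicCoeffIntegers.toPadicAlgCl ιg x)) →
      ∀ (ΩK : ℂ) (Ωp : (PadicComplexInt p)ˣ) (Q : PowerSeries (PadicComplexInt p)), ΩK ≠ 0 →
        IsBDPLFunctionWtSigmaInt ι 𝔭 κ γ g S ΩK ((Ωp : PadicComplexInt p) : ℂ_[p]) Q →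
      -- the complementary (cyclotomic) direction `κ'` with generator `γ'`: `Γ_K = Γ⁺ ⊕ Γ⁻ ≅ ℤ_p²` for `p` odd
      ∀ (κ' : ZpExtension K p) (γ' : absoluteGaloisGroup K) [Fact (κ'.IsTopGenerator γ')], κ'.IsCyclotomic →
      ∀ [TopologicalSpace (PowerSeries (padicCoeffIntegers ιg))]
        [TopologicalSpace (PowerSeries (PowerSeries (padicCoeffIntegers ιg)))]
        [ContinuousSMul (PowerSeries (PowerSeries (padicCoeffIntegers ιg)))
          (BigRepModule (PowerSeries (padicCoeffIntegers ιg)) p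
            (BigRepModule (padicCoeffIntegers ιg) p (Cofree Δ.ρ (padicCoeffField ιg))))],
      -- premise: `X^Σ_K(A_g)` is `Λ_K`-torsion; conclusion: a two-variable frame pinned to `Q` on `X = 0` dividing `Ch_{Λ_K}(X^Σ_K(A_g))`
      Module.IsTorsion (PowerSeries (PowerSeries (padicCoeffIntegers ιg)))
          (XBig κ' (AnticyclotomicBigGaloisRep κ (Δ.cofreeRepOver K)) 𝔭bar (↑S)) →
      ∃ Q₂ : PowerSeries (PowerSeries (PadicComplexInt p)),
        (∃ u : (PowerSeries (PadicComplexInt p))ˣ,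
            PowerSeries.constantCoeff Q₂ = (u : PowerSeries (PadicComplexInt p)) * Q) ∧
        (XBig.charIdeal κ' (AnticyclotomicBigGaloisRep κ (Δ.cofreeRepOver K)) 𝔭bar (↑S)).map
            (PowerSeries.map (PowerSeries.map b)) ≤ Ideal.span {Q₂} := by
  sorry

/-- **S2″ · `stub_finiteFixedPartAnomalous` — (FIX): only FINITELY MANY vectors of `A_g` are fixed by `G_{K̃_{∞,𝔭̄}}` and by
`σ₁`.** For an ordinary newform datum `Δ` (weight `k ≥ 2` even, `p ∤ M`, `p > 3`, `|ι a_p| = 1`), `K` imaginary quadratic with `p`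
split, `𝔭̄ ∣ p`, `κ` anticyclotomic, `κ'` cyclotomic, and `σ₁ ∈ Γ_{K_𝔭̄}` with `κ(σ₁) = 0 ≠ κ'(σ₁)`: the set of `a ∈ A_g` fixed by
every `σ ∈ Γ_{K_𝔭̄}` with `κ'(σ) = κ(σ) = 0` AND by `σ₁` is finite ("`V_g^{⟨P, σ₁⟩} = 0`", `P = G_{K̃_{∞,𝔭̄}}`). TRUE for every datum:
`A_g^P ∩ A⁺ = 0` (a `(p−1)`-torsion inertia element in `P` acts on the ordinary line `A⁺` by `ζ^{k−1} ≠ 1`), `A_g^P ↪ (F/𝒪)(φ)` with `φ`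
the unramified quotient character, and `φ(σ₁) ≠ 1` (local rank two + `κ_ac` ramified above `p` + `φ(Frob) = α_p` no root of unity
[Wiles88 Thm. 2.2, Deligne]); kernel discharge needs the characters of `Δ.fil` as named facts (memo `LOCALDEFECT-25505-imc-p1-g23.md` §1).
Everything downstream ((FIX) ⟹ (FIN-N) `FinN.*` p644528 ∕ `…OfFiniteFixed`; (OPEN) p643213; the sections assembly p641531 ∕ p641842 ∕
p642621; finite-defect control and the S1-fed descent p638561) is the tree's.
[cite: JetchevSkinnerWan2017, §3.3 Case 3(b), §3.4 Lemma 3.4.1 (arXiv:1512.06894 pp. 13–14)] [cite: Wiles1988, Thm. 2.2] -/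
theorem stub_finiteFixedPartAnomalous :
    ∀ {p : ℕ} [Fact p.Prime] {M : ℕ} [NeZero M] {k : ℤ}
      (g : CuspForm (CongruenceSubgroup.Gamma0 M) k) (ιg : coeffField g →+* PadicAlgCl p)
      (Δ : OrdinaryNewformDatum g p ιg)
      (K : Type) [Field K] [NumberField K] (𝔭bar : HeightOneSpectrum (𝓞 K)) (κ κ' : ZpExtension K p),
      IsNewform0 g → 2 ≤ k → Even k → ¬ p ∣ M → 3 < p →
      ‖ιg ⟨(UpperHalfPlane.qExpansion 1 ⇑g).coeff p, coeff_mem_coeffField g p⟩‖ = 1 →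
      IsImaginaryQuadratic K → ((Ideal.span {(p : ℤ)}).primesOver (𝓞 K)).ncard = 2 →
      ((p : ℕ) : 𝓞 K) ∈ 𝔭bar.asIdeal → κ.IsAnticyclotomic → κ'.IsCyclotomic →
      ∀ σ₁ : LocalGroup K (Sum.inl 𝔭bar), κ (localMap K (Sum.inl 𝔭bar) σ₁) = 1 →
        κ' (localMap K (Sum.inl 𝔭bar) σ₁) ≠ 1 →
        {a : Cofree Δ.ρ (padicCoeffField ιg) |
          (∀ σ : LocalGroup K (Sum.inl 𝔭bar), κ' (localMap K (Sum.inl 𝔭bar) σ) = 1 →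
            κ (localMap K (Sum.inl 𝔭bar) σ) = 1 →
            (Δ.cofreeRepOver K) (localMap K (Sum.inl 𝔭bar) σ) a = a) ∧
          (Δ.cofreeRepOver K) (localMap K (Sum.inl 𝔭bar) σ₁) a = a}.Finite := by
  sorry

/-! ## Stub statements by name -/

namespace Statement

/-- Statement of `stub_FW21_twoVarSigmaLePinned` (the open two-variable core). -/
abbrev stub_FW21_twoVarSigmaLePinned : Prop := type_of% @ErratumChain.stub_FW21_twoVarSigmaLePinned
/-- Statement of `stub_finiteFixedPartAnomalous` ((FIX): finitely many `⟨G_{K̃_{∞,𝔭̄}}, σ₁⟩`-fixed vectors of `A_g`, v6). -/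
abbrev stub_finiteFixedPartAnomalous : Prop := type_of% @ErratumChain.stub_finiteFixedPartAnomalous

end Statement

/-! ## The composition (sorry-free): the two stub STATEMENTS imply the crux, BY NAME -/

/-- **`ErratumThm23SigmaLe_of`** (v6) — the erratum's chain BY NAME: the tree theorems
`Theorems.ErratumThm23TwoVariable.ErratumChainV4.erratumThm23SigmaLe_of_twoVarCore_of_localDefect` (imc-p1 g22) and
`Theorems.ErratumThm23TwoVariable.LocalDefectAtData.stub_localDefectFiniteAnomalous_of_finiteFixed` (imc-p1 g23: the finite local
defect from (FIX), via (FIX) ⟹ (FIN-N), (OPEN) a theorem, and the sections of the iterate over `ℤ_p²/c(Γ_{K_𝔭̄})`). Pure logic here. -/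
theorem ErratumThm23SigmaLe_of (hFW : Statement.stub_FW21_twoVarSigmaLePinned)
    (hX : Statement.stub_finiteFixedPartAnomalous) :
    Summit.BirchSwinnertonDyer.BirchSwinnertonDyer.Theses.ErratumRoadFive.ErratumThm23SigmaLe :=
  Summit.BirchSwinnertonDyer.BirchSwinnertonDyer.Theorems.ErratumThm23TwoVariable.ErratumChainV4.erratumThm23SigmaLe_of_twoVarCore_of_localDefect
    hFW
    (Summit.BirchSwinnertonDyer.BirchSwinnertonDyer.Theorems.ErratumThm23TwoVariable.LocalDefectAtData.stub_localDefectFiniteAnomalous_of_finiteFixed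
      hX)

/-- The crux along this line, MODULO exactly the two registered stubs (sorries live only in `stub_*`). -/
theorem ErratumThm23SigmaLe_proof :
    Summit.BirchSwinnertonDyer.BirchSwinnertonDyer.Theses.ErratumRoadFive.ErratumThm23SigmaLe :=
  ErratumThm23SigmaLe_of stub_FW21_twoVarSigmaLePinned stub_finiteFixedPartAnomalous

end Summit.BirchSwinnertonDyer.BirchSwinnertonDyer.Cruxes.ErratumThm23SigmaLe.ErratumChain

end
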